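import Summits.BirchSwinnertonDyer.Rank1Residual.X11b.ClassClosureCongruenceTransport
import Summits.BirchSwinnertonDyer.Rank1Residual.X11a.BaseChangeRoute
import HarnessLib

/-!
# Class X11b = N8/O2 (lane CLASS-CLOSURE, seat `cc-typer-3`): the `¬Ram` atom's IRREDUCIBLE RESIDUE
# typed BY NAME — Mazur's main conjecture at the pair (`X2.MazurMainConjectureAt`) feeds the lever
# without `μ = 0`, and on the "très ramifié" cells the ONE open input is the SAME typed statement as
# class N7's residue, `X11a.BaseChangeLowerBoundAt` (Burungale–Castella–Skinner at a multiplicative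
# prime) (cell `b2b-bsdres`)

HONEST FRAMING (verbatim, cell `b2b-bsdres`, run/shared/lean/b2b/bsd-rank1-residual/): the goal of
the cell is to DELETE the COMBINATION-SHAPED residual classes for ALL analytic-rank `≤ 1` curves
over `ℚ` — "full BSD formula for every rank `≤ 1` curve in class `C`" assembled STRICTLY from
published theorems — so that the rank-`≤ 1` remainder becomes exactly the CONSTRUCTION-SHAPED
classes, which are TYPED (missing-input Props), NOT attempted; this is not "finishing BSD".
Lane CLASS-CLOSURE (coordinator ruling 2026-08-21T04:07Z), item (2): "sub-classes where the existing
argument extends near-verbatim (→ provers) vs the irreducible new sub-case (→ ideation with a sharp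
target)". THEOREMS ONLY (no definition, no named fact, no `sorry`); nothing booked; X11b stays
CONSTRUCTION-SHAPED; every theorem is CONDITIONAL on the named facts and per-pair inputs it lists.

## The `¬Ram` atom of N8 after the congruence transport (`ClassClosureCongruenceTransport.lean`)

Census (obsanat 0.2.5 `N8/pairs.tsv` + `E2-hypotheses.tsv`, cc-eng-2 `cong-eng2-links` = cc-eng-3
`congruence-levelchange`, Cremona galrep; `HOME/class-closure/O2/TRANSPORT-typer3.md` §3a; EVIDENCE):
the 138 `¬Ram` cells at `p ≥ 5` are 57 "peu ramifié" (`p ∣ v_p(Δ_min)`: 50 with a screened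
good-at-`p` partner CURVE → the transport lemma modulo finite certificates; 7 with no rational
partner in the screens) and **81 "très ramifié"** (`p ∤ v_p(Δ_min)`: `E[p]` is not finite at `p`, so
NO weight-two member of `H(ρ̄)` has level prime to `p` — no good partner can exist; all 81 have
`ρ̄` onto). For these the only `(E, p)`-level statement that feeds the lever is Mazur's main
conjecture at the multiplicative prime itself — WITHOUT Skinner's (ram) and, this file observes,
WITHOUT the `μ = 0` clause that the Emerton–Pollack–Weston shape carries (the lever never uses
`HasUnitContent`). That statement is already TYPED in the tree, twice:
* `X2.MazurMainConjectureAt W p` (`X2/Cells.lean`; integral, Néron-normalised, with the trivial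
  zero; verbatim the conclusion of Skinner 2016 Thm. A) — the typed input of X2b and, by
  `X11a.ramTwistLowerBoundAt_iff_mazurMainConjectureAt` (this seat, GEN 0, p250923), of N7's
  twist-(ram) road;
* `X11a.BaseChangeLowerBoundAt W p` (`X11a/BaseChangeRoute.lean`, x11a gen 23, p249880: the integral
  Burungale–Castella–Skinner display (5.3) at `p ‖ N` — "BCS Prop. 5.2.1 at a multiplicative prime",
  MISSING in print: Steinberg specialisation of Wan 2015 Thm. 3 + the integrality step), which gives
  `X2.MazurMainConjectureAt W p` for `p ≥ 5` and `ρ̄` onto through Kato–Wuthrich A32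
  (`X11a.mazurMainConjectureAt_of_baseChangeLowerBound`, rank-free).
So: **N8's très-ramifié residue and N7's residue are ONE typed statement**
(`X11a.BaseChangeLowerBoundAt`), read in rank one through the lever (modulo the pair's Schneider
certificate and, at a split `p`, Disegni's second multiplicative prime) instead of rank zero through
Greenberg–Stevens. Sharp target for ideation, both classes: that statement. Nothing else is new here.

## Contents (all CONDITIONAL; nothing booked)
* `bsdp_of_mazurMainConjectureAt_of_nonsplit_of_schneider`, `…_of_split_of_five_le_of_schneider`,
  `bsdp_of_mazurMainConjectureAt_of_regulatorNonvanishing` — X11b (analytic rank one) twins of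
  x11a's `bsdp_of_mazurMainConjectureAt_heightFree`: `X2.MazurMainConjectureAt W p` + the lever ⇒
  `BSD(E,p)`; no (ram), no `μ`.
* `bsdp_of_baseChangeLowerBound_of_regulatorNonvanishing` — X11b ∧ `p ≥ 5` ∧ `ρ̄` onto:
  `X11a.BaseChangeLowerBoundAt W p` + Kato–Wuthrich A32 + the lever ⇒ `BSD(E,p)`; the rank-one twin of
  `X11a.bsdp_of_baseChangeLowerBound`.
Bookkeeping (not re-proved here, `dedup.landed`): the EPW shape implies Mazur's statement —
x11a's `X11a.mazurMainConjectureAt_of_multCharIdealMuZero` (`X11a/CMPartner.lean`) — so the transport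
file's `bsdp_of_multCharIdealMuZero_of_regulatorNonvanishing` factors through
`bsdp_of_mazurMainConjectureAt_of_regulatorNonvanishing` below: `μ = 0` is used only INSIDE the
Emerton–Pollack–Weston transfer, never by the lever.

References: [Skinner2016PacificMC] Thm. A, §3.2–3.3 (shape); [BurungaleCastellaSkinner2025] Prop.
5.2.1, (5.3), proof of Thm. 1.1.2; [Wuthrich2014] Thm. 3, Cor. 19; [SteinWuthrich2013] Thm. 6.1,
§4.2; [Disegni2020] Thm. 1 (§1.2), (∗); [EmertonPollackWeston2006] statement 5.1.1; [Miller2011LMS]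
Def. 1.1.
-/

set_option autoImplicit false

noncomputable section

open scoped Classical MatrixGroups ModularForm

open CongruenceSubgroup WeierstrassCurve Literature.NumberTheory.EllipticCurves
  Literature.NumberTheory.EllipticCurves.ModularForms
  Literature.NumberTheory.EllipticCurves.Rank1Residual
  Literature.NumberTheory.EllipticCurves.Rank1Residual.Typed
  Literature.NumberTheory.EllipticCurves.Skinner2016
  Literature.NumberTheory.EllipticCurves.SteinWuthrich2013
  Literature.NumberTheory.EllipticCurves.Wuthrich2014
  Literature.NumberTheory.EllipticCurves.Disegni2020
  Literature.NumberTheory.EllipticCurves.GreenbergVatsal2000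
  Literature.NumberTheory.EllipticCurves.EmertonPollackWeston2006

namespace Summit.BirchSwinnertonDyer.Rank1Residual.X11b.ClassClosure

variable (W : WeierstrassCurve ℚ) [W.IsElliptic] [W.IsGloballyMinimal] (p : ℕ) [Fact p.Prime]

/-! ### The lever fed by Mazur's main conjecture at the pair — no (ram), no `μ` -/

/-- **X11b, NON-SPLIT at the odd prime `p`: `BSD(E,p)` from Mazur's main conjecture at the pair
(`hMC : X2.MazurMainConjectureAt W p`), Stein–Wuthrich 2013 Thm. 6.1 (`hJ`), SW §4.2 height existence
(`hH`), Disegni 2020 Thm. 1 NON-SPLIT clause AT THE PAIR (`hD`, inline), GZK, modularity and the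
pair's Schneider certificate (`hSch`).** The analytic-rank-ONE twin of
`X2.bsdp_of_mazurMainConjectureAt_of_analyticRank_eq_zero_heightFree` / x11a's
`bsdp_of_mazurMainConjectureAt_heightFree`; (ram) and `μ = 0` NOT used. CONDITIONAL; nothing booked.
[cite: Skinner2016PacificMC, Thm. A (§1) with §3.2–3.3 (shape only)]
[cite: SteinWuthrich2013, Thm. 6.1 (p. 20) and §4.2] [cite: Disegni2020, Thm. 1 (§1.2)]
[cite: Miller2011LMS, Def. 1.1] -/
theorem bsdp_of_mazurMainConjectureAt_of_nonsplit_of_schneider (hJ : thm61_nonsplitMultiplicative)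
    (hH : exists_isMultCanonical) (hGZK : rank_eq_analyticRank_of_analyticRank_le_one)
    (hpar : nonempty_modularParametrizationData)
    (hD : ∀ {N : ℕ} [NeZero N] {f : CuspForm (Gamma0 N) 2}, IsNewformOf W f →
      ∀ (ϖ : ℚ), ϖ ≠ 0 → (ϖ : ℝ) * W.realPeriodRat = plusPeriod f →
      ∀ (q : ℚ_[p]), q ≠ 0 → ‖q‖ < 1 → tateJ q = (W.j : ℚ_[p]) →
      ∀ (L : PowerSeries ℚ_[p]), IsMultPAdicLFunctionOf f p (-1) L →
      ∀ (Dh : PAdicHeightData W p), IsMultCanonical Dh q →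
        ∃ (s : ℚ) (u : ℤ_[p]ˣ), shaAn W = (s : ℂ) ∧
          ((ϖ : ℚ) : ℚ_[p]) * PowerSeries.coeff 1 L * padicLog p (cyclotomicGenerator p) *
              (W.torsionOrder : ℚ_[p]) ^ 2 =
            ((u : ℤ_[p]) : ℚ_[p]) * (2 * ((s : ℚ_[p]) * padicRegulator Dh * W.tamagawaProduct)))
    (hX : ClassX11b W p) (hns : ¬ W.HasSplitMultiplicativeReductionAtPrime p)
    (hMC : X2.MazurMainConjectureAt W p)
    (hSch : ∀ (q : ℚ_[p]) (Dh : PAdicHeightData W p), q ≠ 0 → ‖q‖ < 1 → tateJ q = (W.j : ℚ_[p]) →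
      IsMultCanonical Dh q → SchneiderConjecture Dh) :
    BSDp W p := by
  obtain ⟨hr, hp2, hmult, -⟩ := hX
  obtain ⟨κ, hκ, γ, hγ, hγ'⟩ := exists_isCyclotomic_isTopGenerator_isCyclotomicVariable_holds p
  obtain ⟨D⟩ := W.nonempty_selmerDualData_holds κ γ hγ
  haveI : NeZero (W.conductorNorm ℤ) := ⟨(W.conductorNorm_pos_holds).ne'⟩
  obtain ⟨Dm⟩ := hpar W
  obtain ⟨ϖ, hϖpos, hϖ, -⟩ := Dm.exists_rat_mul_realPeriodRat_eq_plusPeriod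
  obtain ⟨L, hL⟩ := exists_isMultPAdicLFunctionOf_neg_one_of_nonsplit Dm.isNewformOf hmult hns
  obtain ⟨q, ⟨hq0, hq1, hqj⟩, -⟩ := existsUnique_tateJ_eq_of_one_lt_norm
    (one_lt_norm_j_of_hasMultiplicativeReductionAtPrime (W := W) (p := p) hmult)
  obtain ⟨Dh, hDh⟩ := hH W p hp2 hmult hns q hq0 hq1 hqj
  -- Mazur's statement for this data (non-split clause)
  obtain ⟨hXt, g, hchar, -, hnsp⟩ := hMC κ γ hκ hγ hγ' _ Dm.isNewformOf D ϖ hϖ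
  obtain ⟨w, hw⟩ := hnsp hns L hL
  -- (D) Disegni Thm. 1, non-split clause, at the pair
  obtain ⟨s, u', hs, hDis⟩ := hD Dm.isNewformOf ϖ hϖpos.ne' hϖ q hq0 hq1 hqj L hL Dh hDh
  exact bsdp_of_nonsplit_of_relativeLeadingTerm_of_schneider W p hJ hGZK hp2 hr hmult hns hq0 hq1 hqj
    hκ hγ hγ' D hXt hchar w hw Dh hDh hs u' hDis (hSch q Dh hq0 hq1 hqj hDh)

/-- **X11b, SPLIT at `p ≥ 5`: `BSD(E,p)` from Mazur's main conjecture at the pair, Stein–Wuthrich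
Thm. 6.1 split (`hJ`), the modified §4.2 height (`hH`), Disegni 2020 Thm. 1 SPLIT clause AT THE PAIR
(`hD`, inline; hypothesis (∗): `p ≥ 5` and a second multiplicative prime `hm`, explicit), GZK,
modularity, `𝓛_p ≠ 0` (tree theorem) and the pair's Schneider certificate.** (ram), `μ` NOT used.
CONDITIONAL; nothing booked. [cite: Skinner2016PacificMC, Thm. A (§1) with §3.2–3.3 (shape only)]
[cite: SteinWuthrich2013, Thm. 6.1 (p. 20) and §4.2] [cite: Disegni2020, Thm. 1 (§1.2), hypothesis (∗)]
[cite: Miller2011LMS, Def. 1.1] -/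
theorem bsdp_of_mazurMainConjectureAt_of_split_of_five_le_of_schneider
    (hJ : thm61_splitMultiplicative) (hH : exists_isSplitMultCanonical)
    (hGZK : rank_eq_analyticRank_of_analyticRank_le_one) (hpar : nonempty_modularParametrizationData)
    (hD : ∀ {N : ℕ} [NeZero N] {f : CuspForm (Gamma0 N) 2}, IsNewformOf W f →
      ∀ (ϖ : ℚ), ϖ ≠ 0 → (ϖ : ℝ) * W.realPeriodRat = plusPeriod f →
      5 ≤ p → (∃ (m : ℕ) (_ : Fact m.Prime), m ≠ p ∧ W.HasMultiplicativeReductionAtPrime m) →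
      ∀ (Dq : TateParameterData W p) (L : PowerSeries ℚ_[p]), IsSplitMultPAdicLFunctionOf f p L →
      ∀ (Dh : PAdicHeightData W p), IsSplitMultCanonical Dh Dq →
        ∃ (s : ℚ) (u : ℤ_[p]ˣ), shaAn W = (s : ℂ) ∧
          ((ϖ : ℚ) : ℚ_[p]) * PowerSeries.coeff 2 L * padicLog p (cyclotomicGenerator p) ^ 2 *
              (W.torsionOrder : ℚ_[p]) ^ 2 =
            ((u : ℤ_[p]) : ℚ_[p]) *
              (LInvariant Dq * ((s : ℚ_[p]) * padicRegulator Dh * W.tamagawaProduct)))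
    (hX : ClassX11b W p) (hsplit : W.HasSplitMultiplicativeReductionAtPrime p) (hp5 : 5 ≤ p)
    (hm : ∃ (m : ℕ) (_ : Fact m.Prime), m ≠ p ∧ W.HasMultiplicativeReductionAtPrime m)
    (hMC : X2.MazurMainConjectureAt W p)
    (hSch : ∀ (Dq : TateParameterData W p) (Dh : PAdicHeightData W p),
      IsSplitMultCanonical Dh Dq → SchneiderConjecture Dh) :
    BSDp W p := by
  obtain ⟨hr, hp2, -, -⟩ := hX
  obtain ⟨κ, hκ, γ, hγ, hγ'⟩ := exists_isCyclotomic_isTopGenerator_isCyclotomicVariable_holds p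
  obtain ⟨D⟩ := W.nonempty_selmerDualData_holds κ γ hγ
  haveI : NeZero (W.conductorNorm ℤ) := ⟨(W.conductorNorm_pos_holds).ne'⟩
  obtain ⟨Dm⟩ := hpar W
  obtain ⟨ϖ, hϖpos, hϖ, -⟩ := Dm.exists_rat_mul_realPeriodRat_eq_plusPeriod
  obtain ⟨L, hL⟩ := exists_isSplitMultPAdicLFunctionOf hsplit Dm.isNewformOf
  obtain ⟨Dq⟩ := (nonempty_tateParameterData_iff_holds (W := W) (p := p)).mpr hsplit
  obtain ⟨Dh, hDh⟩ := hH W p hp2 Dq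
  -- Mazur's statement for this data (split clause)
  obtain ⟨hXt, g, hchar, hsp, -⟩ := hMC κ γ hκ hγ hγ' _ Dm.isNewformOf D ϖ hϖ
  obtain ⟨w, hw⟩ := hsp hsplit L hL
  -- (D) Disegni Thm. 1, split clause, at the pair
  obtain ⟨s, u', hs, hDis⟩ := hD Dm.isNewformOf ϖ hϖpos.ne' hϖ hp5 hm Dq L hL Dh hDh
  exact bsdp_of_split_of_relativeLeadingTerm_of_schneider W p hJ hGZK hp2 hr Dq hκ hγ hγ' D hXt hchar
    w hw Dh hDh hs u' hDis (hSch Dq Dh hDh)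

/-- **X11b at `p`, BOTH reduction signs: `BSD(E,p)` from Mazur's main conjecture at the pair
(`X2.MazurMainConjectureAt W p` — the typed input shared with X2b and, through
`X11a.ramTwistLowerBoundAt_iff_mazurMainConjectureAt`, with N7), the PUBLISHED named facts
(Stein–Wuthrich Thm. 6.1 ×2, §4.2 existence ×2, Disegni 2020 Thm. 1 `hD`, GZK, modularity) and the
ONE per-pair input `RegulatorNonvanishingAt W p`; at a SPLIT `p` Disegni's (∗) is the binder
`hcorner`.** No (ram), no `μ = 0`, any `#Ш_an`, irreducible image suffices. CONDITIONAL; nothing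
booked. [cite: Skinner2016PacificMC, Thm. A (§1) with §3.2–3.3 (shape only)]
[cite: SteinWuthrich2013, Thm. 6.1, §4.2] [cite: Disegni2020, Thm. 1 (§1.2), hypothesis (∗)]
[cite: Miller2011LMS, Def. 1.1] -/
theorem bsdp_of_mazurMainConjectureAt_of_regulatorNonvanishing (hJn : thm61_nonsplitMultiplicative)
    (hJs : thm61_splitMultiplicative) (hHn : exists_isMultCanonical) (hHs : exists_isSplitMultCanonical)
    (hD : thm1_padicBSD_rankOne_multiplicative)
    (hGZK : rank_eq_analyticRank_of_analyticRank_le_one) (hpar : nonempty_modularParametrizationData)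
    (hX : ClassX11b W p)
    (hcorner : W.HasSplitMultiplicativeReductionAtPrime p →
      5 ≤ p ∧ ∃ (m : ℕ) (_ : Fact m.Prime), m ≠ p ∧ W.HasMultiplicativeReductionAtPrime m)
    (hMC : X2.MazurMainConjectureAt W p) (hReg : RegulatorNonvanishingAt W p) : BSDp W p := by
  by_cases hsplit : W.HasSplitMultiplicativeReductionAtPrime p
  · obtain ⟨hp5, hm⟩ := hcorner hsplit
    exact bsdp_of_mazurMainConjectureAt_of_split_of_five_le_of_schneider W p hJs hHs hGZK hpar
      (fun hf ϖ hϖ0 hϖ hp5' hm' Dq L hL Dh hDh =>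
        thm1_padicBSD_rankOne_multiplicative.split hD W p hX.2.1 hX.2.2.1 hX.1 hf ϖ hϖ0 hϖ hsplit hp5'
          hm' Dq L hL Dh hDh)
      hX hsplit hp5 hm hMC hReg.2
  · exact bsdp_of_mazurMainConjectureAt_of_nonsplit_of_schneider W p hJn hHn hGZK hpar
      (fun hf ϖ hϖ0 hϖ q hq0 hq1 hqj L hL Dh hDh =>
        thm1_padicBSD_rankOne_multiplicative.nonsplit hD W p hX.2.1 hX.2.2.1 hX.1 hf ϖ hϖ0 hϖ hsplit
          hq0 hq1 hqj L hL Dh hDh)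
      hX hsplit hMC hReg.1

/-! ### The très-ramifié residue of N8's `¬Ram` atom: the SAME typed open input as N7 -/

/-- **N8 ∧ `p ≥ 5` ∧ `ρ̄` onto (in particular the 81 "très ramifié" `¬Ram` cells, where no congruence
partner exists): `BSD(E,p)` from the ONE typed OPEN input `X11a.BaseChangeLowerBoundAt W p` (the
integral Burungale–Castella–Skinner display (5.3) at a multiplicative prime — class N7's irreducible
residue, x11a gen 23), the PUBLISHED named facts Kato–Wuthrich A32 (`hKato`), Stein–Wuthrich Thm. 6.1
×2 + §4.2 ×2, Disegni 2020 Thm. 1 (`hD`), GZK, modularity, and the per-pair inputs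
`RegulatorNonvanishingAt W p` (REG-MULT certificate) and, at a split `p`, a second multiplicative
prime (`hm`).** Glue: `X11a.mazurMainConjectureAt_of_baseChangeLowerBound` (rank-free) +
`bsdp_of_mazurMainConjectureAt_of_regulatorNonvanishing`. The analytic-rank-ONE twin of
`X11a.bsdp_of_baseChangeLowerBound`; so N7's residue and N8's très-ramifié residue are ONE statement
for ideation. NO (ram), NO `μ`-certificate. CONDITIONAL on an OPEN typed input; nothing booked; X11b
stays CONSTRUCTION-SHAPED.
[cite: BurungaleCastellaSkinner2025, "Proof of Theorem 1.1.2" with (5.3)–(5.4) (arXiv:2405.00270v2 p. 10) and Prop. 5.2.1 (shape of the open input)]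
[cite: Wuthrich2014, Thm. 3 and Cor. 19 (pp. 383, 398–399)] [cite: SteinWuthrich2013, Thm. 6.1, §4.2]
[cite: Disegni2020, Thm. 1 (§1.2), hypothesis (∗)] [cite: Miller2011LMS, Def. 1.1] -/
theorem bsdp_of_baseChangeLowerBound_of_regulatorNonvanishing
    (hKato : kato_charIdeal_dvd_multiplicative_of_surjective)
    (hJn : thm61_nonsplitMultiplicative) (hJs : thm61_splitMultiplicative)
    (hHn : exists_isMultCanonical) (hHs : exists_isSplitMultCanonical)
    (hD : thm1_padicBSD_rankOne_multiplicative)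
    (hGZK : rank_eq_analyticRank_of_analyticRank_le_one) (hpar : nonempty_modularParametrizationData)
    (hp5 : 5 ≤ p) (hX : ClassX11b W p) (hsurj : Surj W p)
    (hm : W.HasSplitMultiplicativeReductionAtPrime p →
      ∃ (m : ℕ) (_ : Fact m.Prime), m ≠ p ∧ W.HasMultiplicativeReductionAtPrime m)
    (hBC : X11a.BaseChangeLowerBoundAt W p) (hReg : RegulatorNonvanishingAt W p) : BSDp W p :=
  bsdp_of_mazurMainConjectureAt_of_regulatorNonvanishing W p hJn hJs hHn hHs hD hGZK hpar hX
    (fun hs => ⟨hp5, hm hs⟩)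
    (X11a.mazurMainConjectureAt_of_baseChangeLowerBound W p hKato hpar hp5 hX.2.2.1 hsurj hBC) hReg

end Summit.BirchSwinnertonDyer.Rank1Residual.X11b.ClassClosure

end
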